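import Literature.NumberTheory.EllipticCurves.Tian2014.CMPointSystemGaloisGeneration
import HarnessLib

/-!
# The three displayed sentences on the class `[ϖ′]` of Tian 2014 §4.2 — «`[ϖ′]` has order `2`», «`[ϖ′] ≠ 1`»,
# «`[ϖ′] = [𝔭_p]·[𝔭_q]`» — as KERNEL THEOREMS of the other displayed statements on `𝒮⁻`: the displayed hypothesis of
# the route-A corner of record (`tian2014_system_sMinus_autReduced`, referee B ROUND 742) REDUCED by three sentences,
# with the reduced fact EQUIVALENT to the displayed one

Cell `bsd-monsky` (typer seat, g12). A DERIVABILITY audit of the displayed hypothesis `hSys⁸ =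
tian2014_system_sMinus_autReduced` of the corner `congruentSilentEvenFiveBSDTwo_of_autSystemReduced_descent` (referee B
ROUND 742, 2026-08-27T12:40Z): the consumption audit of g11 (`CMPointSystemGaloisGeneration.lean`) asked which displayed
conjuncts the kernel chain USES; this one asks which displayed conjuncts are kernel CONSEQUENCES of the other displayed
conjuncts (on the family `𝒮⁻`, with Mathlib). Exactly three are, all three sentences on the class `[ϖ′]` of the
uniformizer `ϖ′ = ϖ(1 + ϖ)` (the prime above `2`):
* `galoisFactsReduced`, conjunct 5 (b): «`[ϖ′] ≠ 1`» (Tian §4.2 p0022 L58–L60 «`ϖ′` … is also a uniformizer»; Monsky p. 51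
  «`m` is ambiguous», Thm. 5.5 proof «`m ∉ G²`») — a theorem of Thm. 2.8 (3) alone: `z_{[ϖ′]·1} − z_1 = (±1, 0)`, an affine
  point, not `0`; if `[ϖ′] = 1` the left side is `z_1 − z_1 = 0` (`piPrime_ne_one_of_thm28_3`).
* `GenusTheoryDisplays`, conjunct 3: «`[ϖ′] = [𝔭_p]·[𝔭_q]`» (derived in that display's docstring from `(√−2n) = 𝔭₂𝔭_p𝔭_q`,
  Tian Notations J122 L16–L20, §4.2 p0022 L58–L60) — on `𝒮⁻` a theorem of Tian's Notations (i) («`𝒜[2]` consists of the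
  classes of `ϖ_d`», displayed as `𝒜[2] ⊆ {1, [ϖ′], [𝔭_p], [𝔭_q]}`), `[𝔭_p]² = [𝔭_q]² = 1` and the genus rule (iii) at
  the four pairs: `[𝔭_p][𝔭_q]` is `2`-torsion, and the Artin symbols of `[𝔭_p]`, `[𝔭_q]` on `√p`, `√−q` (the values of
  `Monsky1990.ramifiedClassActions_of_genusRule`: `σ_{[𝔭_p]}` fixes `√p`, negates `√−q`; `σ_{[𝔭_q]}` negates `√p`) exclude
  `[𝔭_p][𝔭_q] ∈ {1, [𝔭_p], [𝔭_q]}` (`piPrime_eq_mul_of_twoTorsion_of_genusRule`).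
* `galoisFactsReduced`, conjunct 5 (a): «`[ϖ′]` has order `2`» (`[𝔭₂]² = [(2)] = 1`) — a theorem of the previous one:
  `[ϖ′]² = [𝔭_p]²[𝔭_q]² = 1` (`piPrime_mul_piPrime_of_genusTheoryDisplays`).
The displays WITHOUT these three sentences — `galoisFactsCore` (four conjuncts), `PrintedCore`, `GenusTheoryDisplaysCore`
(fourteen conjuncts) — give the named fact `tian2014_system_sMinus_autCore` (`hSys⁹`), EQUIVALENT to `hSys⁸` (and so to
`hSys⁷`) in the kernel: `tian2014_system_sMinus_autReduced_iff_autCore`, `tian2014_system_sMinus_aut_iff_autCore`. The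
reading carriers of record (P `tyzPhiParam`, M5 `tyzZN`, inside `GrossZagierAut`) are displayed verbatim as before.

WHAT WAS CHECKED AND FOUND NOT DERIVABLE (the census, for the record — no minimality is claimed): every remaining
conjunct pins a datum no other conjunct constrains. `thm28_1`–`thm28_3`, `eq48`: the four printed relations among the
points `z_t`, the only sentences on `z`. `galoisFactsCore` (1) (`σ_t` fixes `i`, `√−2n`), (2) (`σ_{1+ϖ}` moves `i`, fixes
`√−2n`, `σ_{1+ϖ}² = 1`), (3) (`c` moves `i` and `√−2n`, `c² = 1`), (4) (`Gal(H(i)/K) = ⟨{σ_t}, σ_{1+ϖ}⟩`): the actions on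
`i` are constrained by nothing else; the actions of `σ_{1+ϖ}` and `c` on `√−2n` are tied to their displayed actions on
`√p`, `√−q` only through `√2 = √−2n/(√p·√−q)`, whose conjugates are NOT displayed (Tian's «`√2 ∈ H₀`» is not in the
display); `σ_{1+ϖ}² = 1` and `c² = 1` are constrained only on the points `z_t` (by Thm. 2.8 (1)(2)), which are not
displayed to separate automorphisms; (4) is the Artin surjection. `GenusTheoryDisplaysCore`: `√p, √−q ∈ H(i)` (the
witnesses), `[𝔭_p]² = [𝔭_q]² = 1`, `𝒜[2] ⊆ {…}` (the `2`-rank), `2𝒜 = Gal(H/H₀)`, the genus rule at the four pairs, and the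
actions of `σ_{1+ϖ}`, `c` on `√p`, `√−q` are each about a different datum. `GrossZagierAut`: `𝓛(2n) ∈ ℤ`, `𝓛(1)` odd, TYZ
Thm. 3.3 at `χ₀`, TYZ p. 749 through `ϕ`, and the displays M1, M3, M5, M6 and the split sentences of M2, M4, M7 are on
pairwise different abstract data (`f`, `ϕ`, the predicate of M2, `T(B)` and the predicate of M4, `τ`, `z_N`, `w`); «`T(B²)`
is the multiplication by `−1`» would follow from «`T(B)` of exact order `4`», «`Aut(E′_ℂ) ≅ ℤ[i]^×`» and «`[i]² = [−1]`» only
if `E′(ℂ)` were displayed not to be killed by `2`, which it is not.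

HONEST FRAMING (README §1 of the cell): nothing asserted; every `def … : Prop` below is a sub-conjunction of a display
already in the tree (`CMPointSystemDisplays.lean`, `CMPointSystemGenusBridge.lean`, `CMPointSystemGaloisGeneration.lean`)
with the same locators; the kernel content is the arithmetic of the `2`-torsion of the class group and one inequality of
points. No `_holds`; the conjecture `Prop`s stay `@[conjecture]`.
[cite: Tian2014, Def. 2.7 (p0011 L25–L36), Thm. 2.8 (p0011 L37–L44 = J132), §4.2 (p0022 L47–L60), Notations (i)–(iii) (J122 L41–54 = p0005 L22–L41), (4.8) (p0023 L46–L50)]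
[cite: Monsky1990MockHeegner, p. 51, p. 52, Thm. 5.5 proof (p. 62)]
-/

noncomputable section

open scoped Classical NumberTheorySymbols

open WeierstrassCurve NumberField Literature.NumberTheory.EllipticCurves
  Literature.NumberTheory.EllipticCurves.TianYuanZhang2017

namespace Literature.NumberTheory.EllipticCurves.Tian2014

namespace CMPointData

variable {n : ℕ}

/-! ## §1 The Galois facts without the two sentences on `[ϖ′]` -/

/-- **The Galois facts of Tian 2014 §2 / §4.2 WITHOUT the two sentences on the class `[ϖ′]`**: conjuncts 1, 2, 3, 5 of
`galoisFacts` (= conjuncts 1–4 of `galoisFactsReduced`) — `σ_t` fixes `i` and `√−2n` («`σ_t` fixing `i`», Def. 2.7;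
`𝒜 ≅ Gal(H(i)/K(i))`, p0022 L56–L57); `σ_{1+ϖ}` is «the involution of `H(i)/H`» (moves `i`, fixes `√−2n ∈ H`, squares
to the identity); complex conjugation moves `i` and `√−2n` and is an involution; the subgroup `Gal(H(i)/K)` of the
automorphisms fixing `√−2n` is generated by `Gal(H(i)/K(i)) = {σ_t}` and `σ_{1+ϖ}` («`i ∉ H`», p0022 L52–L53). The removed
fifth conjunct («`[ϖ′]` has order `2`» and «`[ϖ′] ≠ 1`») is PROVED on `𝒮⁻` from Thm. 2.8 (3) and the genus-theory display
(`piPrime_ne_one_of_thm28_3`, `piPrime_mul_piPrime_of_genusTheoryDisplays`).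
[cite: Tian2014, Def. 2.7 (p0011 L35–L36), §4.2 (p0022 L52–L60)] -/
def galoisFactsCore (D : CMPointData n) : Prop :=
  (∀ s, D.art s D.im = D.im ∧ D.art s D.sqrtNegTwoN = D.sqrtNegTwoN) ∧
  (D.tau D.im = -D.im ∧ D.tau D.sqrtNegTwoN = D.sqrtNegTwoN ∧ D.tau * D.tau = 1) ∧
  (D.conj D.im = -D.im ∧ D.conj D.sqrtNegTwoN = -D.sqrtNegTwoN ∧ D.conj * D.conj = 1) ∧
  (∀ σ : D.H ≃ₐ[ℚ] D.H, σ D.sqrtNegTwoN = D.sqrtNegTwoN →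
    σ ∈ Subgroup.closure (Set.range D.art ∪ {D.tau}))

/-- The core facts are a sub-conjunction of the reduced facts (projection). [cite: Tian2014, §4.2 (p0022 L52–L60)] [folklore] -/
theorem galoisFactsCore_of_galoisFactsReduced (D : CMPointData n) (h : D.galoisFactsReduced) : D.galoisFactsCore := by
  obtain ⟨h1, h2, h3, h5, -⟩ := h
  exact ⟨h1, h2, h3, h5⟩

/-- The reduced facts from the core facts and the two sentences on `[ϖ′]`. [cite: Tian2014, §4.2 (p0022 L52–L60)] [folklore] -/
theorem galoisFactsReduced_of_galoisFactsCore (D : CMPointData n) (h : D.galoisFactsCore)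
    (hπ2 : D.piPrime * D.piPrime = 1) (hπ1 : D.piPrime ≠ 1) : D.galoisFactsReduced := by
  obtain ⟨h1, h2, h3, h5⟩ := h
  exact ⟨h1, h2, h3, h5, hπ2, hπ1⟩

/-! ## §2 «`[ϖ′] ≠ 1`» is a theorem of Thm. 2.8 (3) -/

/-- **«`[ϖ′] ≠ 1`» from Thm. 2.8 (3)**: `z_{[ϖ′]·1} − z_1 = (1, 0)` or `(−1, 0)` — an affine point, not `0` — while
`[ϖ′] = 1` would make it `z_1 − z_1 = 0`. [cite: Tian2014, Thm. 2.8 (3) (p0011 L42–L44)] [cite: Monsky1990MockHeegner, p. 51] -/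
theorem piPrime_ne_one_of_thm28_3 (D : CMPointData n) (h : D.thm28_3) : D.piPrime ≠ 1 := by
  intro hπ
  have h1 := h 1
  rw [hπ, one_mul, sub_self] at h1
  split_ifs at h1 with h7
  · exact WeierstrassCurve.Affine.Point.some_ne_zero _ h1.symm
  · exact WeierstrassCurve.Affine.Point.some_ne_zero _ h1.symm

/-! ## §3 The genus-theory display without «`[ϖ′] = [𝔭_p]·[𝔭_q]`» -/

/-- **The genus theory of `K = ℚ(√−2pq)` on `𝒮⁻` as Tian prints it, WITHOUT the derived sentence «`[ϖ′] = [𝔭_p]·[𝔭_q]`»**: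
the fourteen other conjuncts of `GenusTheoryDisplays` verbatim — `√p, √−q ∈ H(i)`; `[𝔭_p]² = [𝔭_q]² = 1` and
`𝒜[2] ⊆ {1, [ϖ′], [𝔭_p], [𝔭_q]}` (Notations (i)); `t ∈ 2𝒜` iff `σ_t` fixes `√p`, `√−q` (Notations (ii)); the genus rule at
the four pairs `(d, ℓ) ∈ {p, q}²` (Notations (iii)); `σ_{1+ϖ}` fixes `√p`, `√−q`; complex conjugation fixes `√p`, negates
`√−q`. The removed conjunct is PROVED on `𝒮⁻` from these (`piPrime_eq_mul_of_twoTorsion_of_genusRule`).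
[cite: Tian2014, Notations (J122 L26–54 = p0005 L5–L41; J123 L4–L15 = p0005 L47–L59), Thm. 2.8 (1)(2) (p0011 L39–L41)]
[cite: Monsky1990MockHeegner, p. 52 ¶2] -/
def GenusTheoryDisplaysCore {p q : ℕ} (D : CMPointData (p * q)) : Prop :=
  ∃ (sqrtP sqrtNegQ : D.H) (cp cq : ClassGroup (𝓞 (GenusField (2 * (p * q))))),
    sqrtP ^ 2 = p ∧ sqrtNegQ ^ 2 = -q ∧ cp * cp = 1 ∧ cq * cq = 1 ∧
    (∀ t : ClassGroup (𝓞 (GenusField (2 * (p * q)))), t * t = 1 → t = 1 ∨ t = D.piPrime ∨ t = cp ∨ t = cq) ∧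
    (∀ t, IsSquare t ↔ (D.art t sqrtP = sqrtP ∧ D.art t sqrtNegQ = sqrtNegQ)) ∧
    (D.art cp sqrtP = sqrtP ↔ J(2 * q | p) = 1) ∧ (D.art cp sqrtNegQ = sqrtNegQ ↔ J(p | q) = 1) ∧
    (D.art cq sqrtP = sqrtP ↔ J(q | p) = 1) ∧ (D.art cq sqrtNegQ = sqrtNegQ ↔ J(2 * p | q) = 1) ∧
    D.tau sqrtP = sqrtP ∧ D.tau sqrtNegQ = sqrtNegQ ∧ D.conj sqrtP = sqrtP ∧ D.conj sqrtNegQ = -sqrtNegQ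

/-- The core genus display is a sub-conjunction of `GenusTheoryDisplays` (projection).
[cite: Tian2014, Notations (J122–123)] [folklore] -/
theorem genusTheoryDisplaysCore_of_genusTheoryDisplays {p q : ℕ} (D : CMPointData (p * q))
    (h : D.GenusTheoryDisplays) : D.GenusTheoryDisplaysCore := by
  obtain ⟨sqrtP, sqrtNegQ, cp, cq, hPs, hQs, -, hcp2, hcq2, h2tor, hsq, r1, r2, r3, r4, hτP, hτQ, hcP, hcQ⟩ := h
  exact ⟨sqrtP, sqrtNegQ, cp, cq, hPs, hQs, hcp2, hcq2, h2tor, hsq, r1, r2, r3, r4, hτP, hτQ, hcP, hcQ⟩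

/-- **«`[ϖ′] = [𝔭_p]·[𝔭_q]`» is a KERNEL THEOREM of Tian's Notations (i) and (iii) on `𝒮⁻`**: `[𝔭_p][𝔭_q]` is `2`-torsion,
so by (i) it is one of `1`, `[ϖ′]`, `[𝔭_p]`, `[𝔭_q]`; the genus rule (iii) on the family gives `σ_{[𝔭_p]}(√p) = √p`,
`σ_{[𝔭_p]}(√−q) = −√−q`, `σ_{[𝔭_q]}(√p) = −√p` (`Monsky1990.ramifiedClassActions_of_genusRule`), so `[𝔭_p] ≠ 1`, `[𝔭_q] ≠ 1`,
`[𝔭_p] ≠ [𝔭_q]`, which excludes `1` (`[𝔭_p][𝔭_q] = 1` forces `[𝔭_p] = [𝔭_q]`), `[𝔭_p]` (forces `[𝔭_q] = 1`) and `[𝔭_q]`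
(forces `[𝔭_p] = 1`). [cite: Tian2014, Notations (i), (iii) (J122 L41–54 = p0005 L22–L41), §4.2 (p0022 L58–L60)]
[cite: Monsky1990MockHeegner, p. 52 ¶2–3] -/
theorem piPrime_eq_mul_of_twoTorsion_of_genusRule {p q : ℕ} (D : CMPointData (p * q)) (hp : p.Prime)
    (hq : q.Prime) (hp8 : p % 8 = 5) (hq4 : q % 4 = 3) (hpq : J(p | q) = -1) {sqrtP sqrtNegQ : D.H}
    (hPs : sqrtP ^ 2 = p) (hQs : sqrtNegQ ^ 2 = -q) {cp cq : ClassGroup (𝓞 (GenusField (2 * (p * q))))}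
    (hcp2 : cp * cp = 1) (hcq2 : cq * cq = 1)
    (h2tor : ∀ t : ClassGroup (𝓞 (GenusField (2 * (p * q)))), t * t = 1 → t = 1 ∨ t = D.piPrime ∨ t = cp ∨ t = cq)
    (r1 : D.art cp sqrtP = sqrtP ↔ J(2 * q | p) = 1) (r2 : D.art cp sqrtNegQ = sqrtNegQ ↔ J(p | q) = 1)
    (r3 : D.art cq sqrtP = sqrtP ↔ J(q | p) = 1) (r4 : D.art cq sqrtNegQ = sqrtNegQ ↔ J(2 * p | q) = 1) :
    D.piPrime = cp * cq := by
  obtain ⟨hsP, hsQ⟩ := Monsky1990.sqrt_ne_zero_of_prime hp hq hPs hQs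
  obtain ⟨hcpP, hcpQ, hcqP, -⟩ :=
    Monsky1990.ramifiedClassActions_of_genusRule D.art hp8 hq4 hpq hPs hQs r1 r2 r3 r4
  have hcp1 : cp ≠ 1 := by
    intro h
    rw [h, map_one, AlgEquiv.one_apply] at hcpQ
    exact hsQ (CharZero.eq_neg_self_iff.mp hcpQ)
  have hcq1 : cq ≠ 1 := by
    intro h
    rw [h, map_one, AlgEquiv.one_apply] at hcqP
    exact hsP (CharZero.eq_neg_self_iff.mp hcqP)
  have hcpcq : cp ≠ cq := by
    intro h
    rw [h, hcqP] at hcpP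
    exact hsP (CharZero.neg_eq_self_iff.mp hcpP)
  have h2 : (cp * cq) * (cp * cq) = 1 := by
    rw [mul_mul_mul_comm, hcp2, hcq2, one_mul]
  rcases h2tor _ h2 with h | h | h | h
  · exfalso
    apply hcpcq
    calc cp = cp * (cq * cq) := by rw [hcq2, mul_one]
      _ = (cp * cq) * cq := by rw [mul_assoc]
      _ = cq := by rw [h, one_mul]
  · exact h.symm
  · exact absurd (mul_left_cancel (h.trans (mul_one cp).symm)) hcq1
  · exact absurd (mul_right_cancel (h.trans (one_mul cq).symm)) hcp1

/-- **`GenusTheoryDisplays` from the core genus display on `𝒮⁻`**: the removed conjunct is supplied by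
`piPrime_eq_mul_of_twoTorsion_of_genusRule`. [cite: Tian2014, Notations (i)–(iii) (J122 L41–54 = p0005 L22–L41)] -/
theorem genusTheoryDisplays_of_genusTheoryDisplaysCore {p q : ℕ} (D : CMPointData (p * q)) (hp : p.Prime)
    (hq : q.Prime) (hp8 : p % 8 = 5) (hq4 : q % 4 = 3) (hpq : J(p | q) = -1) (h : D.GenusTheoryDisplaysCore) :
    D.GenusTheoryDisplays := by
  obtain ⟨sqrtP, sqrtNegQ, cp, cq, hPs, hQs, hcp2, hcq2, h2tor, hsq, r1, r2, r3, r4, hτP, hτQ, hcP, hcQ⟩ := h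
  exact ⟨sqrtP, sqrtNegQ, cp, cq, hPs, hQs,
    D.piPrime_eq_mul_of_twoTorsion_of_genusRule hp hq hp8 hq4 hpq hPs hQs hcp2 hcq2 h2tor r1 r2 r3 r4,
    hcp2, hcq2, h2tor, hsq, r1, r2, r3, r4, hτP, hτQ, hcP, hcQ⟩

/-- The two genus displays are equivalent on `𝒮⁻`. [cite: Tian2014, Notations (i)–(iii) (J122 L41–54 = p0005 L22–L41)] -/
theorem genusTheoryDisplays_iff_genusTheoryDisplaysCore {p q : ℕ} (D : CMPointData (p * q)) (hp : p.Prime)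
    (hq : q.Prime) (hp8 : p % 8 = 5) (hq4 : q % 4 = 3) (hpq : J(p | q) = -1) :
    D.GenusTheoryDisplays ↔ D.GenusTheoryDisplaysCore :=
  ⟨D.genusTheoryDisplaysCore_of_genusTheoryDisplays,
    D.genusTheoryDisplays_of_genusTheoryDisplaysCore hp hq hp8 hq4 hpq⟩

/-! ## §4 «`[ϖ′]` has order `2`» is a theorem of the genus display -/

/-- **«`[ϖ′]` has order `2`» from the genus display**: `[ϖ′]² = [𝔭_p]²[𝔭_q]² = 1`.
[cite: Tian2014, Notations (i) (J122 L41–44), §4.2 (p0022 L58–L60)] [cite: Monsky1990MockHeegner, p. 51] -/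
theorem piPrime_mul_piPrime_of_genusTheoryDisplays {p q : ℕ} (D : CMPointData (p * q))
    (h : D.GenusTheoryDisplays) : D.piPrime * D.piPrime = 1 := by
  obtain ⟨-, -, cp, cq, -, -, hm, hcp2, hcq2, -⟩ := h
  rw [hm, mul_mul_mul_comm, hcp2, hcq2, one_mul]

/-! ## §5 The core display of Tian 2014 §2 / §4.2 -/

/-- **The displayed statements of Tian 2014 §2 / §4.2 with the two sentences on `[ϖ′]` removed as well**: Thm. 2.8
(1)–(3), (4.8) and `galoisFactsCore`. Equivalent to `PrintedReduced` given «`[ϖ′]` has order `2`»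
(`printedReduced_of_printedCore`; «`[ϖ′] ≠ 1`» is supplied by Thm. 2.8 (3)).
[cite: Tian2014, Thm. 2.8 (p0011 L37–L44), (4.8) (p0023 L46–L50), §4.2 (p0022 L52–L60)] -/
def PrintedCore (D : CMPointData n) : Prop :=
  D.thm28_1 ∧ D.thm28_2 ∧ D.thm28_3 ∧ D.eq48 ∧ D.galoisFactsCore

/-- `PrintedReduced ⟹ PrintedCore` (projection). [cite: Tian2014, Thm. 2.8 (p0011 L37–L44)] [folklore] -/
theorem printedCore_of_printedReduced (D : CMPointData n) (h : D.PrintedReduced) : D.PrintedCore := by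
  obtain ⟨h1, h2, h3, h4, h5⟩ := h
  exact ⟨h1, h2, h3, h4, D.galoisFactsCore_of_galoisFactsReduced h5⟩

/-- `PrintedCore ⟹ PrintedReduced` given «`[ϖ′]` has order `2`» («`[ϖ′] ≠ 1`» is a theorem of Thm. 2.8 (3)).
[cite: Tian2014, Thm. 2.8 (3) (p0011 L42–L44), §4.2 (p0022 L58–L60)] -/
theorem printedReduced_of_printedCore (D : CMPointData n) (h : D.PrintedCore)
    (hπ : D.piPrime * D.piPrime = 1) : D.PrintedReduced := by
  obtain ⟨h1, h2, h3, h4, h5⟩ := h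
  exact ⟨h1, h2, h3, h4, D.galoisFactsReduced_of_galoisFactsCore h5 hπ (D.piPrime_ne_one_of_thm28_3 h3)⟩

end CMPointData

/-! ## §6 The aut system fact with the core displays -/

/-- **THE AUT SYSTEM FACT WITH THE THREE SENTENCES ON `[ϖ′]` REMOVED**: as `tian2014_system_sMinus_autReduced` (Tian's
CM-point system on `𝒮⁻`: `GrossZagierAut` — TYZ Thm. 3.3 at `χ₀` + TYZ p. 749 through `ϕ` + the bridge displays with M2, M4,
M7 split into printed sentences — and the genus theory of `K = ℚ(√−2pq)` as printed) with `PrintedReduced` replaced by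
`PrintedCore` (Thm. 2.8 (1)–(3), (4.8), the Galois facts on `i`, `√−2n` and the generation of `Gal(H(i)/K)`) and
`GenusTheoryDisplays` replaced by `GenusTheoryDisplaysCore` (Tian's Notations (i)–(iii) and the actions of `σ_{1+ϖ}`, `c` on
`√p`, `√−q`): WITHOUT «`[ϖ′]` has order `2`», «`[ϖ′] ≠ 1`» and «`[ϖ′] = [𝔭_p]·[𝔭_q]`», which the core displays prove on
`𝒮⁻`. Existential over ONE system per `(p, q)`; EQUIVALENT to `tian2014_system_sMinus_autReduced` and to
`tian2014_system_sMinus_aut` (`tian2014_system_sMinus_autReduced_iff_autCore`, `tian2014_system_sMinus_aut_iff_autCore`),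
hence implies `…_param`, `…_cusp`, `…_maximal`, `…_bridged`, `…_split`, `…_genus` and every enclosure form of the cell.
Printed-but-unproved content = that of the reduced aut fact minus the three sentences. Nothing asserted; no `_holds` expected.
[cite: Tian2014, Def. 2.7, Thm. 2.8 (p0011 L25–L44 = J132), Prop. 2.1 (p0006 L23–L75 = J124 L25–J125 L35), p0007 L22–L29 (J126 L2–L7), p0003 L1–L5, §2 (p0005 L77–L79), §4.2 (p0022 L52–L60), (4.8) (p0023 L46–L50), Notations (J122–123)]
[cite: TianYuanZhang2017, Thm. 3.3 (p. 739) and its proof (pp. 749–751), §2 (p0007 L112), §3.1, §3.2 (p0012 L8–L18), J747, J751, Lemma 3.16 (p0017 L98–L113), Thm. 1.1, Thm. 1.4] -/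
def tian2014_system_sMinus_autCore : Prop :=
  ∀ p q : ℕ, (hp : p.Prime) → (hq : q.Prime) → p % 8 = 5 → q % 4 = 3 → jacobiSym p q = -1 →
    ∃ D : CMPointData (p * q), D.PrintedCore ∧
      D.GrossZagierAut (Nat.mul_ne_zero hp.ne_zero hq.ne_zero) ∧ D.GenusTheoryDisplaysCore

/-- The core aut fact implies the reduced aut fact (the three sentences on `[ϖ′]` are kernel theorems of the core displays on
`𝒮⁻`). [cite: Tian2014, Thm. 2.8 (3) (p0011 L42–L44), Notations (i)–(iii) (J122 L41–54), §4.2 (p0022 L58–L60)] -/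
theorem tian2014_system_sMinus_autReduced_of_autCore (h : tian2014_system_sMinus_autCore) :
    tian2014_system_sMinus_autReduced := by
  intro p q hp hq hp5 hq4 hj
  obtain ⟨D, hP, hG, hGen⟩ := h p q hp hq hp5 hq4 hj
  have hGen' : D.GenusTheoryDisplays := D.genusTheoryDisplays_of_genusTheoryDisplaysCore hp hq hp5 hq4 hj hGen
  exact ⟨D, D.printedReduced_of_printedCore hP (D.piPrime_mul_piPrime_of_genusTheoryDisplays hGen'), hG, hGen'⟩

/-- The reduced aut fact implies the core aut fact (projection). [cite: Tian2014, Thm. 2.8 (p0011 L37–L44)] [folklore] -/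
theorem tian2014_system_sMinus_autCore_of_autReduced (h : tian2014_system_sMinus_autReduced) :
    tian2014_system_sMinus_autCore := by
  intro p q hp hq hp5 hq4 hj
  obtain ⟨D, hP, hG, hGen⟩ := h p q hp hq hp5 hq4 hj
  exact ⟨D, D.printedCore_of_printedReduced hP, hG, D.genusTheoryDisplaysCore_of_genusTheoryDisplays hGen⟩

/-- The reduced and the core aut facts are equivalent. [cite: Tian2014, Thm. 2.8 (3), Notations (i)–(iii) (J122 L41–54)] -/
theorem tian2014_system_sMinus_autReduced_iff_autCore :
    tian2014_system_sMinus_autReduced ↔ tian2014_system_sMinus_autCore :=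
  ⟨tian2014_system_sMinus_autCore_of_autReduced, tian2014_system_sMinus_autReduced_of_autCore⟩

/-- The core aut fact implies the aut fact. [cite: Tian2014, Prop. 4.6 proof (p0023 L26–L28), Thm. 2.8 (3), Notations (i)–(iii)] -/
theorem tian2014_system_sMinus_aut_of_autCore (h : tian2014_system_sMinus_autCore) :
    tian2014_system_sMinus_aut :=
  tian2014_system_sMinus_aut_of_autReduced (tian2014_system_sMinus_autReduced_of_autCore h)

/-- The aut fact implies the core aut fact (projection). [cite: Tian2014, Thm. 2.8 (p0011 L37–L44)] [folklore] -/
theorem tian2014_system_sMinus_autCore_of_aut (h : tian2014_system_sMinus_aut) :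
    tian2014_system_sMinus_autCore :=
  tian2014_system_sMinus_autCore_of_autReduced (tian2014_system_sMinus_autReduced_of_aut h)

/-- The aut fact and the core aut fact are equivalent: the displayed hypothesis of the route-A corner may be read with or
without Tian's Prop. 4.6 generation sentence and the three sentences on `[ϖ′]`.
[cite: Tian2014, Prop. 4.6 proof (p0023 L26–L28), Thm. 2.8 (3) (p0011 L42–L44), Notations (i)–(iii) (J122 L41–54)] -/
theorem tian2014_system_sMinus_aut_iff_autCore :
    tian2014_system_sMinus_aut ↔ tian2014_system_sMinus_autCore :=
  ⟨tian2014_system_sMinus_autCore_of_aut, tian2014_system_sMinus_aut_of_autCore⟩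

/-- The core aut fact implies the maximal fact. [cite: Tian2014, Prop. 2.1, Prop. 4.6 proof (p0023 L26–L28)] [cite: TianYuanZhang2017, §2, §3.2, Lemma 3.16] -/
theorem tian2014_system_sMinus_maximal_of_autCore (h : tian2014_system_sMinus_autCore) :
    tian2014_system_sMinus_maximal :=
  tian2014_system_sMinus_maximal_of_aut (tian2014_system_sMinus_aut_of_autCore h)

end Literature.NumberTheory.EllipticCurves.Tian2014

end
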